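import Summits.Ventures.HSemireg.WedgeHankelRecurrenceLienardChipartDeterminants

/-!
# Venture HSemireg — THE ROUTH–HURWITZ CHAPTER AS ONE `TFAE`: for a real polynomial `p` of degree `n` with positive leading coefficient the following are equivalent — (1) all roots in `Re z < 0`;
# (2) the Hermite–Fujiwara matrix `H_n(p)` is positive definite (F–H Thm 5.55); (3) `sigPos H_n(p) = n`; (4) all Hurwitz determinants `Δ_1, …, Δ_n` are positive (Gantmacher (36)); (5)/(6)
# Liénard–Chipart: all coefficients positive and `Δ_2, Δ_4, … > 0`, resp. `Δ_1, Δ_3, … > 0` (Gantmacher Thm 11); (7) Routh's first-column test (Gantmacher XV §3, constant-term scheme);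
# (8) Strelitz: the coefficients of `p` and of its pair-sum polynomial `q` are positive (Prasolov Thm 1.1.14)

HONEST FRAMING. Part of the Lean index of the computation cell `pub-hsemireg` (seat p10 gen 39, Sunday typer «UNIFORM-IN-n»).  An INDEX THEOREM assembling equivalences already in the tree
(N187, N199, N211, N212, N222); nothing new is proved beyond the assembly.  No variety, no cohomology theory, no sheaf, no Ext group and no semiregularity map is constructed here; nothing here says
that HC / HC_CM / HC_AV holds; no Literature fact (unproved `Prop`) is declared or used.  Custodian versions as in `WedgeHankelSiegelIdeal` (1/3).
SOURCES (cited, as in the leaves): Fuhrmann–Helmke (2015) Thm 5.53 ∕ 5.55; Gantmacher Ch. XV §3, §6 (36), §13 Thm 11; Hairer–Nørsett–Wanner I Thm 13.4; Prasolov, *Polynomials* Thm 1.1.14 (Strelitz).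
DEDUP DISCLOSURE: the eight statements are IMPORTED (N187 `posDef_hermiteFujiwara_real_iff`, `forall_re_neg_iff_sigPos_eq`; N211 `forall_re_neg_iff_forall_det_hurwitzMatrix_pos`; N222
`lienard_chipart_even ∕ _odd`; N212 `forall_re_neg_iff_routh`; N199 `forall_re_neg_iff_strelitz`); this file only chains them.  The 1 name below: 0 hits tree-wide.
THIS FILE (namespace `Summit.Ventures.HSemireg.Wedge.HankelOuter` continued; CHAINED on N222; 0 definitions): §945 **`routh_hurwitz_tfae`**.
CAVEATS.  All for REAL polynomials with `lc > 0` and exact degree `n`; the complex-coefficient criterion is N186 (`H_n(p) ≻ 0`).  Nothing Ext-side.  New names only.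
-/

open Module Polynomial
open scoped Matrix Polynomial

namespace Summit.Ventures.HSemireg.Wedge.HankelOuter

open Summit.Ventures.HSemireg.Wedge Summit.Ventures.HSemireg.Wedge.Hankel

/-! ## §945. The equivalences -/

/-- **ROUTH–HURWITZ, EIGHT WAYS (`TFAE`)** for a real `p` of degree `n` with positive leading coefficient: (1) all roots of `p` in `ℂ` have negative real part; (2) `H_n(p) ≻ 0` (Hermite–Fujiwara);
(3) `sigPos H_n(p) = n`; (4) `Δ_k = det (hurwitzMatrix k p) > 0` for all `k ≤ n`; (5) all `p_k > 0` and `Δ_{2j} > 0` (`2j ≤ n`); (6) all `p_k > 0` and `Δ_{2j+1} > 0` (`2j+1 ≤ n`); (7) Routh's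
first-column test `p^{(i)}_0 p^{(i)}_1 > 0` (`i < n`, `p^{(i)} = routhTransform^[i] p`); (8) all `p_k > 0` and all coefficients of Strelitz' pair-sum polynomial `q = strelitz p` are positive.
[F–H Thm 5.53∕5.55; Gantmacher XV §3, §6 (36), §13 Thm 11; HNW Thm 13.4; Prasolov Thm 1.1.14 — via N187, N211, N222, N212, N199; this file, §945] -/
theorem routh_hurwitz_tfae {n : ℕ} {p : ℝ[X]} (hp : p.natDegree = n) (hlc : 0 < p.leadingCoeff) :
    List.TFAE [
      ∀ z ∈ (p.map (algebraMap ℝ ℂ)).roots, z.re < 0,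
      (hermiteFujiwara n p).PosDef,
      sigPos (hermiteFujiwara n p).toQuadraticForm' = n,
      ∀ k ≤ n, 0 < (hurwitzMatrix k p).det,
      (∀ k ≤ n, 0 < p.coeff k) ∧ ∀ j, 2 * j ≤ n → 0 < (hurwitzMatrix (2 * j) p).det,
      (∀ k ≤ n, 0 < p.coeff k) ∧ ∀ j, 2 * j + 1 ≤ n → 0 < (hurwitzMatrix (2 * j + 1) p).det,
      ∀ i < n, 0 < (routhTransform^[i] p).coeff 0 * (routhTransform^[i] p).coeff 1,
      (∀ k ≤ n, 0 < p.coeff k) ∧ ∀ k ≤ (strelitz p).natDegree, 0 < ((strelitz p).coeff k).re] := by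
  tfae_have 1 ↔ 2 := (posDef_hermiteFujiwara_real_iff hp).symm
  tfae_have 1 ↔ 3 := forall_re_neg_iff_sigPos_eq hp
  tfae_have 1 ↔ 4 := forall_re_neg_iff_forall_det_hurwitzMatrix_pos hp hlc
  tfae_have 1 ↔ 5 := lienard_chipart_even hp hlc
  tfae_have 1 ↔ 6 := lienard_chipart_odd hp hlc
  tfae_have 1 ↔ 7 := forall_re_neg_iff_routh hp
  tfae_have 1 ↔ 8 := by rw [forall_re_neg_iff_strelitz hlc, hp]
  tfae_finish

end Summit.Ventures.HSemireg.Wedge.HankelOuter
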